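import Summits.HubbardSuperconductivity.HubbardSuperconductivity.Theorems.LevyLogBootstrapDressHalfFilledInterHopDiag
import Summits.HubbardSuperconductivity.HubbardSuperconductivity.Theorems.LevyLogBootstrapDressHalfFilledInterHopDiagTerm
import Summits.HubbardSuperconductivity.HubbardSuperconductivity.Theorems.LevyLogBootstrapDressHalfFilledInterHopDiagZero
import HarnessLib

/-!
# Route `LevyLogBootstrap` / `AnisotropyChord`, crux `DressHalfFilled` (stmt-HubbardSuperconductivity-8148), stub 2
# `stub_plaquetteDictionary`, clause (d) — step 4: INTER-PLAQUETTE LOCALITY of Kato's kernel between dictionary columns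

Support file (`--supports stmt-HubbardSuperconductivity-8148`), the assembly of `…InterHopColumns` (step 1: `T col_σ` is a
sum of two-cluster slices of hop vectors), `…InterHopCross` (step 2: different bonds do not talk), `…InterHopDiagTerm` /
`…InterHopDiagZero` (step 3: the same-bond term is Kato's two-plaquette kernel times the environment overlap).

**`star_col_dotProduct_kernel_col`** — on the checkerboard torus of side `2M`, `M ≥ 3`, for two dictionary columns
`col_σ = Π_R ψ_σ(R)` (`TorusPlaquette.plaqFamily`, Koszul product over the plaquette partition) of EQUAL boson number
(`downWeight σ' = downWeight σ`), with `T = hamiltonian G_inter 1 0`, `H_in = hamiltonian G_intra 1 U` and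
`E₀ = Σ_c E_c(σ)` the `H_in`-eigenvalue of the ket column:

  `⟨col_σ', T S_{H_in}(E₀) T col_σ⟩ = -Σ_R Σ_k [σ' = σ off {R, R+e_k}] ·`
  `    interClusterKernel H_plaq (plaquetteStates U) (bondHopping (bonds k)) ((σ' R)ᵛ,(σ' (R+e_k))ᵛ) ((σ R)ᵛ,(σ (R+e_k))ᵛ)`

(`bonds 0 = plaquetteBonds` horizontal, `bonds 1 = plaquetteBondsV` vertical; `ᵛ = Fin.rev`: up spin `0` = one hole
pair = plaquette state `1`). Ingredients: `T` is Hermitian, so the bracket is `⟨T col_σ', S (T col_σ)⟩`; both are bond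
sums of slices of hop vectors (`hamiltonian_inter_mulVec_col`); cross terms vanish (`cross_bond_term_eq_zero`, hop
vectors are odd–odd: `hopVec_ne_zero_imp`); a same-bond term with differing environments vanishes
(`diag_bond_term_eq_zero_of_env_ne`); with equal environments and equal boson number the two bond occupations are equal
or exchanged, so the bond pair energies agree (`pairEnergy_eq_of_downWeight_eq`) and `diag_bond_term_eq` applies.
No `U`-window is needed at this stage (the window enters only through the VALUES of the kernel, `…KernelStructure`).

References: W.-F. Tsai, S. A. Kivelson, PRB 73 (2006) 214510, App. A (A1) [TsaiKivelson2006]; T. Kato (1966) II-§2.2.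
No definition and no named fact is introduced; all statements are [folklore].
-/

set_option linter.dupNamespace false

noncomputable section

namespace Summit.HubbardSuperconductivity.HubbardSuperconductivity.Theorems.LevyLogBootstrap

open Matrix Literature.MathematicalPhysics.QuantumLattice Literature.Probability.LatticeModels
open Literature.MathematicalPhysics.QuantumLattice.TorusPlaquette TwoCluster

/-! ### Linear-algebra bookkeeping -/

/-- For a Hermitian `T`: `⟨x, (T S T) y⟩ = ⟨T x, S (T y)⟩`. [folklore] -/
theorem star_dotProduct_herm_mul_mul_herm_mulVec {N : Type*} [Fintype N] {T : Matrix N N ℂ}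
    (hT : T.IsHermitian) (S : Matrix N N ℂ) (x y : N → ℂ) :
    star x ⬝ᵥ ((T * S * T) *ᵥ y) = star (T *ᵥ x) ⬝ᵥ (S *ᵥ (T *ᵥ y)) := by
  rw [← Matrix.mulVec_mulVec, ← Matrix.mulVec_mulVec, Matrix.dotProduct_mulVec, Matrix.star_mulVec, hT.eq]

/-- A double bond sum against a double bond sum collapses to its diagonal when the cross terms vanish. [folklore] -/
theorem star_sum_sum_dotProduct_mulVec_sum_sum {α β N : Type*} [Fintype α] [DecidableEq α] [Fintype β]
    [DecidableEq β] [Fintype N] (S : Matrix N N ℂ) (a b : α → β → N → ℂ)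
    (hcross : ∀ R k R' k', (R, k) ≠ (R', k') → star (a R k) ⬝ᵥ (S *ᵥ b R' k') = 0) :
    star (∑ R, ∑ k, a R k) ⬝ᵥ (S *ᵥ ∑ R, ∑ k, b R k) = ∑ R, ∑ k, star (a R k) ⬝ᵥ (S *ᵥ b R k) := by
  rw [star_sum, sum_dotProduct]
  refine Finset.sum_congr rfl fun R _ => ?_
  rw [star_sum, sum_dotProduct]
  refine Finset.sum_congr rfl fun k _ => ?_
  rw [Matrix.mulVec_sum, dotProduct_sum, Finset.sum_eq_single_of_mem R (Finset.mem_univ R) ?_]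
  · rw [Matrix.mulVec_sum, dotProduct_sum]
    exact Finset.sum_eq_single_of_mem k (Finset.mem_univ k) fun k' _ hk' =>
      hcross R k R k' fun h => hk' (congrArg Prod.snd h).symm
  · intro R' _ hR'
    rw [Matrix.mulVec_sum, dotProduct_sum]
    exact Finset.sum_eq_zero fun k' _ => hcross R k R' k' fun h => hR' (congrArg Prod.fst h).symm

/-! ### Equal boson number and equal environments force equal bond pair energies -/

/-- Two pairs of bits with the same sum are equal or exchanged. [folklore] -/
theorem fin2_pair_of_sum_eq : ∀ a' b' a b : Fin 2, (a' : ℕ) + b' = a + b →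
    (a' = a ∧ b' = b) ∨ (a' = b ∧ b' = a) := by
  decide

variable {M : ℕ} [NeZero M]

/-- Columns of equal boson number that agree off a bond carry the same total spin on the bond:
`σ'_R + σ'_{R+e_k} = σ_R + σ_{R+e_k}`. [folklore] -/
theorem val_add_val_eq_of_downWeight_eq (hM : 2 ≤ M) {σ' σ : TensorIndex (TorusSite 2 M) 2}
    (hw : downWeight σ' = downWeight σ) (R : FermionTorus 2 M) (k : Fin 2)
    (henv : ∀ c : FermionTorus 2 M, c ≠ plaqNbr R k → c ≠ R →
      σ' (FermionTorus.toTorusSite c) = σ (FermionTorus.toTorusSite c)) :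
    (σ' (FermionTorus.toTorusSite R) : ℕ) + (σ' (FermionTorus.toTorusSite (plaqNbr R k)) : ℕ) =
      (σ (FermionTorus.toTorusSite R) : ℕ) + (σ (FermionTorus.toTorusSite (plaqNbr R k)) : ℕ) := by
  have hRN : R ≠ plaqNbr R k := (plaqNbr_ne hM R k).symm
  have h1 : ∀ τ : TensorIndex (TorusSite 2 M) 2, (downWeight τ : ℤ) =
      ((τ (FermionTorus.toTorusSite R) : ℕ) : ℤ) + ((τ (FermionTorus.toTorusSite (plaqNbr R k)) : ℕ) : ℤ) +
        ∑ c ∈ (Finset.univ.erase R).erase (plaqNbr R k), ((τ (FermionTorus.toTorusSite c) : ℕ) : ℤ) := by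
    intro τ
    rw [downWeight, ← sum_toTorusSite (fun y => (τ y : ℕ)), Nat.cast_sum,
      sum_erase_erase hRN (fun c => ((τ (FermionTorus.toTorusSite c) : ℕ) : ℤ))]
    ring
  have henv' : ∑ c ∈ (Finset.univ.erase R).erase (plaqNbr R k), ((σ' (FermionTorus.toTorusSite c) : ℕ) : ℤ) =
      ∑ c ∈ (Finset.univ.erase R).erase (plaqNbr R k), ((σ (FermionTorus.toTorusSite c) : ℕ) : ℤ) :=
    Finset.sum_congr rfl fun c hc => by
      rw [henv c ((mem_erase_erase_iff _ _ _).1 hc).2 ((mem_erase_erase_iff _ _ _).1 hc).1]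
  have h2 := h1 σ'
  have h3 := h1 σ
  rw [hw, h3, henv'] at h2
  have h4 : ((σ' (FermionTorus.toTorusSite R) : ℕ) : ℤ) + ((σ' (FermionTorus.toTorusSite (plaqNbr R k)) : ℕ) : ℤ) =
      ((σ (FermionTorus.toTorusSite R) : ℕ) : ℤ) + ((σ (FermionTorus.toTorusSite (plaqNbr R k)) : ℕ) : ℤ) := by
    linarith
  exact_mod_cast h4

/-- **Equal boson number + equal environments ⇒ equal bond pair energies**: the bond occupations `κ' = ((σ' R)ᵛ,
(σ' (R+e_k))ᵛ)` and `κ` are then equal or exchanged, and `pairEnergy` is exchange symmetric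
(`pairEnergy_plaquetteStates`). [folklore] -/
theorem pairEnergy_eq_of_downWeight_eq (hM : 2 ≤ M) (U : ℝ) {σ' σ : TensorIndex (TorusSite 2 M) 2}
    (hw : downWeight σ' = downWeight σ) (R : FermionTorus 2 M) (k : Fin 2)
    (henv : ∀ c : FermionTorus 2 M, c ≠ plaqNbr R k → c ≠ R →
      σ' (FermionTorus.toTorusSite c) = σ (FermionTorus.toTorusSite c)) :
    pairEnergy (plaquetteHamiltonian U) (plaquetteStates U)
        ((σ' (FermionTorus.toTorusSite R)).rev, (σ' (FermionTorus.toTorusSite (plaqNbr R k))).rev) =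
      pairEnergy (plaquetteHamiltonian U) (plaquetteStates U)
        ((σ (FermionTorus.toTorusSite R)).rev, (σ (FermionTorus.toTorusSite (plaqNbr R k))).rev) := by
  rcases fin2_pair_of_sum_eq _ _ _ _ (val_add_val_eq_of_downWeight_eq hM hw R k henv) with ⟨ha, hb⟩ | ⟨ha, hb⟩
  · rw [ha, hb]
  · rw [ha, hb, pairEnergy_plaquetteStates, pairEnergy_plaquetteStates, add_comm]

/-! ### The locality statement -/

/-- **INTER-PLAQUETTE LOCALITY OF KATO'S KERNEL BETWEEN DICTIONARY COLUMNS** (`M ≥ 3`, equal boson number; see the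
module docstring): `⟨col_σ', T S_{H_in}(Σ_c E_c(σ)) T col_σ⟩ = -Σ_R Σ_k [σ' = σ off {R, R+e_k}] · K_k(κ'_{R,k}, κ_{R,k})`
with `K_k = interClusterKernel H_plaq (plaquetteStates U) (bondHopping (bonds k))`. [cite: TsaiKivelson2006, App. A (A1)] -/
theorem star_col_dotProduct_kernel_col (hM : 3 ≤ M) (U : ℝ) (σ' σ : TensorIndex (TorusSite 2 M) 2)
    (hw : downWeight σ' = downWeight σ) :
    star ((plaquettePartition M).prodFamily (plaqFamily U σ')) ⬝ᵥ
      ((hamiltonian (fermionTorusGraph 2 (2 * M) ⊓ SimpleGraph.comap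
            (fun x : FermionTorus 2 (2 * M) => fun i : Fin 2 => ((ofLex x) i : ℕ) / 2) ⊤) 1 0 *
          reducedResolvent (hamiltonian (fermionTorusGraph 2 (2 * M) \ SimpleGraph.comap
            (fun x : FermionTorus 2 (2 * M) => fun i : Fin 2 => ((ofLex x) i : ℕ) / 2) ⊤) 1 U)
            (∑ c : FermionTorus 2 M, plaquetteEnergy U (2 * ((Fin.rev (σ (FermionTorus.toTorusSite c)) : Fin 2) : ℕ))) *
          hamiltonian (fermionTorusGraph 2 (2 * M) ⊓ SimpleGraph.comap
            (fun x : FermionTorus 2 (2 * M) => fun i : Fin 2 => ((ofLex x) i : ℕ) / 2) ⊤) 1 0) *ᵥ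
        (plaquettePartition M).prodFamily (plaqFamily U σ)) =
      -∑ R : FermionTorus 2 M, ∑ k : Fin 2,
        (if ∀ c : FermionTorus 2 M, c ≠ plaqNbr R k → c ≠ R →
            σ' (FermionTorus.toTorusSite c) = σ (FermionTorus.toTorusSite c) then (1 : ℂ) else 0) *
          interClusterKernel (plaquetteHamiltonian_isHermitian U) (plaquetteStates U)
            (bondHopping ((![plaquetteBonds, plaquetteBondsV] : Fin 2 → Finset (PlaquetteSite × PlaquetteSite)) k))
            ((σ' (FermionTorus.toTorusSite R)).rev, (σ' (FermionTorus.toTorusSite (plaqNbr R k))).rev)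
            ((σ (FermionTorus.toTorusSite R)).rev, (σ (FermionTorus.toTorusSite (plaqNbr R k))).rev) := by
  have hM2 : 2 ≤ M := by omega
  -- `T` is Hermitian: move one `T` onto the bra
  rw [star_dotProduct_herm_mul_mul_herm_mulVec (LiebThm1.hamiltonian_isHermitian _ 1 0)]
  -- both `T col` are bond sums of slices of hop vectors
  rw [hamiltonian_inter_mulVec_col hM2 U σ', hamiltonian_inter_mulVec_col hM2 U σ, star_neg, Matrix.mulVec_neg,
    neg_dotProduct, dotProduct_neg, neg_neg]
  -- cross terms vanish: collapse to the diagonal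
  refine Eq.trans (star_sum_sum_dotProduct_mulVec_sum_sum _ _ _ fun R k R' k' hne => ?_) ?_
  · exact cross_bond_term_eq_zero hM U σ' σ hne _ (hopVec_ne_zero_imp U σ' R k _ _ _) _
  -- bond by bond
  rw [← Finset.sum_neg_distrib]
  refine Finset.sum_congr rfl fun R _ => ?_
  rw [← Finset.sum_neg_distrib]
  refine Finset.sum_congr rfl fun k _ => ?_
  rw [← mul_neg]
  by_cases henv : ∀ c : FermionTorus 2 M, c ≠ plaqNbr R k → c ≠ R →
      σ' (FermionTorus.toTorusSite c) = σ (FermionTorus.toTorusSite c)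
  · exact diag_bond_term_eq hM2 U σ' σ R k _ (pairEnergy_eq_of_downWeight_eq hM2 U hw R k henv)
  · rw [if_neg henv, zero_mul]
    exact diag_bond_term_eq_zero_of_env_ne hM2 U σ' σ R k _ _ _ henv

end Summit.HubbardSuperconductivity.HubbardSuperconductivity.Theorems.LevyLogBootstrap

end
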